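import Summits.AtomisticToContinuum.HydrodynamicLimit.Theses.JParityClosure
import Summits.AtomisticToContinuum.HydrodynamicLimit.Theorems.EnskogAdjointDualityDualityReductionMaxwellian
import Summits.AtomisticToContinuum.HydrodynamicLimit.Theorems.EvenStressEnskog.Negative.EnskogSideMoments
import Summits.AtomisticToContinuum.HydrodynamicLimit.Theorems.EvenStressEnskog.Negative.PairFunctionalVanishing
import Literature.MathematicalPhysics.KineticTheory.EvenCollisionTubeFunctional
import Literature.MathematicalPhysics.KineticTheory.KineticEntropyBalanceFunctional
import Literature.MathematicalPhysics.KineticTheory.MicroscaleWindowFunctionals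
import Literature.MathematicalPhysics.KineticTheory.EvenStatTruncationBound
import HarnessLib

/-!
# The pointwise second-moment identity behind the Enskog identification
# (`stub_enskogPointwise`, stub S6a "POINTWISE SECOND-MOMENT IDENTITY" of the line
# `stationary-microscale-hierarchy-entrance-law` of the crux `JParityClosure.EvenStressEnskog`,
# stmt-AtomisticToContinuum-13079)

For ONE configuration `w` of `N + 1` hard spheres, one centre `x`, one pair `(k, l)` and a cone scale `0 < r`,
write `b_i = b_r(x_i, x)` (`coneKernel`), `ρ = (N+1)⁻¹ Σ b_i` (`mollDensity`), `m = (N+1)⁻¹ Σ b_i v_i`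
(`mollMomentum`), `u = ρ⁻¹ m` (`KineticEntropyBalance.uC`), `θ = mollTemperature`, `M = localMaxwellian 1 θ u`,
`F_{kl}(v) = ∫_{S²} ⟪v − u, ω⟫² ω_k ω_l dσ(ω)` and `B_r = pairFunctional r (evenMark k l) w x`.  Then, EXACTLY,

  `ρ² ∫∫ Θ(Ξ_P^{kl})(v, v') M(v) M(v') dv dv' − B_r = ρ (ρ ∫ F_{kl} M dv) − ρ ∫ b_r F_{kl} dμ_w`.

Proof.  (i) EMPIRICAL SIDE (`mollDensity_mul_oneBody_eq_pairFunctional`): by the moment form of the pair functional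
(`pairFunctionalP_eq_moment`: `B_r = (N+1)⁻² ∫ [S₀S₂(ω) − S₁(ω)²] ω_kω_l dω`) and the weighted-variance identity
`S₀ Σ b_i ⟪v_i − u, ω⟫² = S₀ S₂ − S₁²` (`u` the `b`-weighted mean velocity; all `b_i ≥ 0` since `0 < r`, so that
`S₀ = 0` forces every `b_i = 0`), `ρ ∫ b_r F_{kl} dμ_w = B_r`.  (ii) MAXWELLIAN SIDE (`maxwellian_pair_moment_eq`):
`Θ(Ξ_P^{kl})(v, v') = ½ ∫ ⟪v' − v, ω⟫² ω_kω_l dω` (`sphereMarkP_eq_half`); for `θ > 0`, `M dv` is the isotropic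
Gaussian `gaussMeasure u θ` and `∫ ⟪v − p, ω⟫² dN(u, θ id) = ⟪u − p, ω⟫² + θ‖ω‖²` (standard Gaussian covariance
`covarianceBilin_stdGaussian`), whence, after one Fubini exchange with the (finite) sphere measure, both Maxwellian terms
equal `θ ∫ ω_kω_l dω`; for `θ ≤ 0` the tree's `localMaxwellian 1 θ u` is identically `0` (junk `Real.rpow` values) and
both vanish.  (iii) The identity is then `ring`.

References: S. Chapman, T. G. Cowling, *The Mathematical Theory of Non-Uniform Gases* (1970), Ch. 16 (Enskog's
collisional transfer at a local Maxwellian). [folklore]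
-/

noncomputable section

namespace Summit.AtomisticToContinuum.HydrodynamicLimit.Theorems.EvenStressEnskog

open scoped BigOperators InnerProductSpace Topology ENNReal Classical
open MeasureTheory ProbabilityTheory Filter Set
open Literature.MathematicalPhysics.KineticTheory Literature.Analysis.FluidPDE
open Literature.MathematicalPhysics.KineticTheory.StationaryMicroscale
open Summit.AtomisticToContinuum.HydrodynamicLimit.Theses.JParityClosure

/-! ## The local Maxwellian at nonpositive temperature -/

/-- For a nonpositive temperature the tree's local Maxwellian on `V3` is identically zero (junk `Real.rpow`
values: `0 ^ (−3/2) = 0`, and for a negative base the defining factor `cos (−3π/2)` vanishes). [folklore] -/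
theorem localMaxwellian_eq_zero_of_nonpos {θ : ℝ} (hθ : θ ≤ 0) (u v : V3) :
    localMaxwellian 1 θ u v = 0 := by
  unfold localMaxwellian
  have hfin : ((Module.finrank ℝ V3 : ℕ) : ℝ) = 3 := by
    rw [finrank_euclideanSpace_fin]; norm_num
  rw [hfin]
  rcases eq_or_lt_of_le hθ with h0 | hneg
  · subst h0
    have h32 : (0 : ℝ) ^ (-(3 : ℝ) / 2) = 0 := Real.zero_rpow (by norm_num)
    rw [mul_zero, h32, mul_zero, zero_mul]
  · have hb : 2 * Real.pi * θ < 0 := by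
      have hπ := Real.pi_pos
      nlinarith
    rw [Real.rpow_def_of_neg hb]
    have hcos : Real.cos (-(3 : ℝ) / 2 * Real.pi) = 0 := by
      rw [Real.cos_eq_zero_iff]
      exact ⟨-2, by push_cast; ring⟩
    rw [hcos, mul_zero, mul_zero, zero_mul]

/-! ## Gaussian directional second moments -/

/-- Directional second moment of the standard Gaussian on `V3`: `∫ ⟪ω, w⟫² dγ(w) = ‖ω‖²`. [folklore] -/
theorem integral_inner_sq_stdGaussian (ω : V3) :
    ∫ w, ⟪ω, w⟫_ℝ ^ 2 ∂stdGaussian V3 = ‖ω‖ ^ 2 := by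
  have h := covarianceBilin_apply (μ := stdGaussian V3) IsGaussian.memLp_two_id ω ω
  rw [covarianceBilin_stdGaussian, innerSL_apply_apply] at h
  have h0 : ∫ x, id x ∂stdGaussian V3 = 0 := integral_id_stdGaussian
  simp only [h0, sub_zero, ← sq] at h
  rw [← h, real_inner_self_eq_norm_sq]

/-- Directional second moment of the isotropic Gaussian `N(u, θ id)` about an arbitrary point `p`, plus a
constant: `∫ (⟪v − p, ω⟫² + c) dN = ⟪u − p, ω⟫² + θ‖ω‖² + c` (`θ > 0`). [folklore] -/
theorem integral_inner_sub_sq_gaussMeasure {θ : ℝ} (hθ : 0 < θ) (u p ω : V3) (c : ℝ) :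
    ∫ v, (⟪v - p, ω⟫_ℝ ^ 2 + c) ∂gaussMeasure u θ = ⟪u - p, ω⟫_ℝ ^ 2 + θ * ‖ω‖ ^ 2 + c := by
  rw [integral_gaussMeasure u hθ]
  have hs : Real.sqrt θ ^ 2 = θ := Real.sq_sqrt hθ.le
  have hexp : ∀ w : V3, ⟪u + Real.sqrt θ • w - p, ω⟫_ℝ ^ 2 + c =
      (⟪u - p, ω⟫_ℝ ^ 2 + c) + (2 * Real.sqrt θ * ⟪u - p, ω⟫_ℝ) * ⟪ω, w⟫_ℝ + θ * ⟪ω, w⟫_ℝ ^ 2 := by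
    intro w
    have : u + Real.sqrt θ • w - p = (u - p) + Real.sqrt θ • w := by abel
    rw [this, inner_add_left, real_inner_smul_left, real_inner_comm ω w]
    have key : (⟪u - p, ω⟫_ℝ + Real.sqrt θ * ⟪ω, w⟫_ℝ) ^ 2 + c =
        (⟪u - p, ω⟫_ℝ ^ 2 + c) + (2 * Real.sqrt θ * ⟪u - p, ω⟫_ℝ) * ⟪ω, w⟫_ℝ +
          Real.sqrt θ ^ 2 * ⟪ω, w⟫_ℝ ^ 2 := by ring
    rw [key, hs]
  simp_rw [hexp]
  have hi1 : Integrable (fun w : V3 => ⟪ω, w⟫_ℝ) (stdGaussian V3) :=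
    IsGaussian.integrable_fun_id.const_inner ω
  have hm2 : MemLp (fun w : V3 => ⟪ω, w⟫_ℝ) 2 (stdGaussian V3) :=
    IsGaussian.memLp_two_id.const_inner ω
  have hi2 : Integrable (fun w : V3 => ⟪ω, w⟫_ℝ ^ 2) (stdGaussian V3) := hm2.integrable_sq
  have hI0 : ∫ w, ⟪ω, w⟫_ℝ ∂stdGaussian V3 = 0 := by
    rw [integral_inner IsGaussian.integrable_fun_id ω, integral_id_stdGaussian, inner_zero_right]
  have hC : Integrable (fun _ : V3 => ⟪u - p, ω⟫_ℝ ^ 2 + c) (stdGaussian V3) := integrable_const _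
  have hD : Integrable (fun w : V3 => 2 * Real.sqrt θ * ⟪u - p, ω⟫_ℝ * ⟪ω, w⟫_ℝ) (stdGaussian V3) :=
    hi1.const_mul _
  have hCD : Integrable (fun w : V3 => ⟪u - p, ω⟫_ℝ ^ 2 + c + 2 * Real.sqrt θ * ⟪u - p, ω⟫_ℝ * ⟪ω, w⟫_ℝ)
      (stdGaussian V3) := hC.add hD
  have hB : Integrable (fun w : V3 => θ * ⟪ω, w⟫_ℝ ^ 2) (stdGaussian V3) := hi2.const_mul θ
  rw [integral_add hCD hB, integral_add hC hD, integral_const, integral_const_mul,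
    integral_const_mul, hI0, integral_inner_sq_stdGaussian]
  simp only [smul_eq_mul, probReal_univ, one_mul, mul_zero, add_zero]
  ring

/-- Joint integrability on `N(u, θ id) ⊗ σ_{S²}` of the directional second-moment integrand
`(⟪v − p, ω⟫² + c) ω_k ω_l` (dominated by `‖v − p‖² + |c|`). [folklore] -/
theorem integrable_inner_sub_sq_prod {θ : ℝ} (u p : V3) (c : ℝ) (k l : Fin 3) :
    Integrable (fun z : V3 × Metric.sphere (0 : V3) 1 =>
        (⟪z.1 - p, (z.2 : V3)⟫_ℝ ^ 2 + c) * ((z.2 : V3) k * (z.2 : V3) l))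
      ((gaussMeasure u θ).prod sphereMeasure) := by
  haveI := isFiniteMeasure_sphereMeasure_V3
  have h1 : Integrable (fun v : V3 => ‖v - p‖ ^ 2 + |c|) (gaussMeasure u θ) := by
    refine Integrable.add ?_ (integrable_const _)
    have hsq : Integrable (fun v : V3 => ‖v‖ ^ 2) (gaussMeasure u θ) :=
      (IsGaussian.memLp_id _ 2 (by simp)).integrable_norm_pow (by norm_num)
    have hin : Integrable (fun v : V3 => ⟪v, p⟫_ℝ) (gaussMeasure u θ) :=
      IsGaussian.integrable_fun_id.inner_const p
    have : (fun v : V3 => ‖v - p‖ ^ 2) = fun v => ‖v‖ ^ 2 - 2 * ⟪v, p⟫_ℝ + ‖p‖ ^ 2 := by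
      funext v; exact norm_sub_sq_real v p
    rw [this]
    exact (hsq.sub (hin.const_mul 2)).add (integrable_const _)
  have hdom : Integrable (fun z : V3 × Metric.sphere (0 : V3) 1 => ‖z.1 - p‖ ^ 2 + |c|)
      ((gaussMeasure u θ).prod sphereMeasure) := h1.comp_fst sphereMeasure
  refine hdom.mono' (Continuous.aestronglyMeasurable (by fun_prop)) (Eventually.of_forall fun z => ?_)
  have hω : ‖(z.2 : V3)‖ = 1 := norm_coe_unitSphere z.2
  have hk : |(z.2 : V3) k| ≤ 1 := by
    have h := PiLp.norm_apply_le (z.2 : V3) k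
    rw [hω, Real.norm_eq_abs] at h
    exact h
  have hl : |(z.2 : V3) l| ≤ 1 := by
    have h := PiLp.norm_apply_le (z.2 : V3) l
    rw [hω, Real.norm_eq_abs] at h
    exact h
  have hin : |⟪z.1 - p, (z.2 : V3)⟫_ℝ| ≤ ‖z.1 - p‖ := by
    have h := abs_real_inner_le_norm (z.1 - p) (z.2 : V3)
    rw [hω, mul_one] at h
    exact h
  have h1' : |⟪z.1 - p, (z.2 : V3)⟫_ℝ ^ 2 + c| ≤ ‖z.1 - p‖ ^ 2 + |c| := by
    refine (abs_add_le _ _).trans ?_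
    rw [abs_pow]
    have := abs_nonneg ⟪z.1 - p, (z.2 : V3)⟫_ℝ
    nlinarith
  have h2 : |(z.2 : V3) k * (z.2 : V3) l| ≤ 1 := by
    rw [abs_mul]
    nlinarith [abs_nonneg ((z.2 : V3) k), abs_nonneg ((z.2 : V3) l)]
  rw [Real.norm_eq_abs, abs_mul]
  calc |⟪z.1 - p, (z.2 : V3)⟫_ℝ ^ 2 + c| * |(z.2 : V3) k * (z.2 : V3) l|
      ≤ (‖z.1 - p‖ ^ 2 + |c|) * 1 := mul_le_mul h1' h2 (abs_nonneg _) (by positivity)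
    _ = ‖z.1 - p‖ ^ 2 + |c| := mul_one _

/-- **Gaussian average of the sphere-integrated directional second moment** (one Fubini exchange with the
finite sphere measure): `∫ [∫_{S²} (⟪v − p, ω⟫² + c) ω_kω_l dσ] dN(u, θ id)(v) = ∫_{S²} (⟪u − p, ω⟫² + θ + c) ω_kω_l dσ`
(`θ > 0`, `‖ω‖ = 1`). [folklore] -/
theorem integral_gaussMeasure_sphereMoment {θ : ℝ} (hθ : 0 < θ) (u p : V3) (c : ℝ) (k l : Fin 3) :
    ∫ v, (∫ ω : Metric.sphere (0 : V3) 1,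
        (⟪v - p, (ω : V3)⟫_ℝ ^ 2 + c) * ((ω : V3) k * (ω : V3) l) ∂sphereMeasure) ∂gaussMeasure u θ
      = ∫ ω : Metric.sphere (0 : V3) 1,
          (⟪u - p, (ω : V3)⟫_ℝ ^ 2 + θ + c) * ((ω : V3) k * (ω : V3) l) ∂sphereMeasure := by
  haveI := isFiniteMeasure_sphereMeasure_V3
  have hF := integrable_inner_sub_sq_prod (θ := θ) u p c k l
  rw [integral_integral_swap
    (f := fun (v : V3) (ω : Metric.sphere (0 : V3) 1) =>
      (⟪v - p, (ω : V3)⟫_ℝ ^ 2 + c) * ((ω : V3) k * (ω : V3) l)) hF]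
  refine integral_congr_ae (Eventually.of_forall fun ω => ?_)
  simp only
  rw [integral_mul_const, integral_inner_sub_sq_gaussMeasure hθ u p (ω : V3) c, norm_coe_unitSphere,
    one_pow, mul_one]

/-! ## The Maxwellian side -/

/-- **The two Maxwellian second-moment terms of the crux coincide**: for every real `θ` and every `u`,
`∫∫ Θ(Ξ_P^{kl})(v, v') M(v) M(v') dv dv' = ∫ [∫_{S²} ⟪v − u, ω⟫² ω_kω_l dσ] M(v) dv`, `M = localMaxwellian 1 θ u`
(both equal `θ ∫ ω_kω_l dσ` for `θ > 0`, both vanish for `θ ≤ 0`). [folklore] -/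
theorem maxwellian_pair_moment_eq (k l : Fin 3) (θ : ℝ) (u : V3) :
    ∫ v : V3, ∫ v' : V3, sphereMark (evenMark k l) v v' *
          localMaxwellian 1 θ u v * localMaxwellian 1 θ u v'
      = ∫ v : V3, (∫ ω : Metric.sphere (0 : V3) 1,
          ⟪v - u, (ω : V3)⟫_ℝ ^ 2 * ((ω : V3) k * (ω : V3) l) ∂sphereMeasure) * localMaxwellian 1 θ u v := by
  rcases le_or_gt θ 0 with hθ | hθ
  · have h0 : ∀ v, localMaxwellian 1 θ u v = 0 := fun v => localMaxwellian_eq_zero_of_nonpos hθ u v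
    simp [h0]
  have hΘ : ∀ v v' : V3, sphereMark (evenMark k l) v v' =
      1 / 2 * ∫ ω : Metric.sphere (0 : V3) 1,
        ⟪v' - v, ((ω : V3))⟫_ℝ ^ 2 * ((ω : V3) k * (ω : V3) l) ∂sphereMeasure := by
    intro v v'
    unfold sphereMark evenMark
    exact sphereMarkP_eq_half k l v v'
  set K : ℝ := ∫ ω : Metric.sphere (0 : V3) 1, θ * ((ω : V3) k * (ω : V3) l) ∂sphereMeasure with hK
  -- the one-body Maxwellian term
  have hFM : ∫ v : V3, (∫ ω : Metric.sphere (0 : V3) 1,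
      ⟪v - u, (ω : V3)⟫_ℝ ^ 2 * ((ω : V3) k * (ω : V3) l) ∂sphereMeasure) * localMaxwellian 1 θ u v = K := by
    calc ∫ v : V3, (∫ ω : Metric.sphere (0 : V3) 1,
          ⟪v - u, (ω : V3)⟫_ℝ ^ 2 * ((ω : V3) k * (ω : V3) l) ∂sphereMeasure) * localMaxwellian 1 θ u v
        = ∫ v : V3, localMaxwellian 1 θ u v * (∫ ω : Metric.sphere (0 : V3) 1,
            (⟪v - u, (ω : V3)⟫_ℝ ^ 2 + 0) * ((ω : V3) k * (ω : V3) l) ∂sphereMeasure) := by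
          refine integral_congr_ae (Eventually.of_forall fun v => ?_)
          simp only [add_zero]
          ring
      _ = ∫ v : V3, (∫ ω : Metric.sphere (0 : V3) 1,
            (⟪v - u, (ω : V3)⟫_ℝ ^ 2 + 0) * ((ω : V3) k * (ω : V3) l) ∂sphereMeasure) ∂gaussMeasure u θ :=
          integral_localMaxwellian_mul_eq_integral_gaussMeasure hθ u _
      _ = ∫ ω : Metric.sphere (0 : V3) 1,
            (⟪u - u, (ω : V3)⟫_ℝ ^ 2 + θ + 0) * ((ω : V3) k * (ω : V3) l) ∂sphereMeasure :=
          integral_gaussMeasure_sphereMoment hθ u u 0 k l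
      _ = K := by
          rw [hK]
          congr 1
          funext ω
          simp
  -- the inner integral of the two-body Maxwellian term
  have hinner : ∀ v : V3, ∫ v' : V3, sphereMark (evenMark k l) v v' *
        localMaxwellian 1 θ u v * localMaxwellian 1 θ u v'
      = localMaxwellian 1 θ u v * (1 / 2 * ∫ ω : Metric.sphere (0 : V3) 1,
          (⟪v - u, (ω : V3)⟫_ℝ ^ 2 + θ) * ((ω : V3) k * (ω : V3) l) ∂sphereMeasure) := by
    intro v
    calc ∫ v' : V3, sphereMark (evenMark k l) v v' * localMaxwellian 1 θ u v * localMaxwellian 1 θ u v'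
        = ∫ v' : V3, localMaxwellian 1 θ u v * (localMaxwellian 1 θ u v' *
            (1 / 2 * ∫ ω : Metric.sphere (0 : V3) 1,
              (⟪v' - v, (ω : V3)⟫_ℝ ^ 2 + 0) * ((ω : V3) k * (ω : V3) l) ∂sphereMeasure)) := by
          refine integral_congr_ae (Eventually.of_forall fun v' => ?_)
          simp only [hΘ, add_zero]
          ring
      _ = localMaxwellian 1 θ u v * ∫ v' : V3, localMaxwellian 1 θ u v' *
            (1 / 2 * ∫ ω : Metric.sphere (0 : V3) 1,
              (⟪v' - v, (ω : V3)⟫_ℝ ^ 2 + 0) * ((ω : V3) k * (ω : V3) l) ∂sphereMeasure) :=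
          integral_const_mul _ _
      _ = localMaxwellian 1 θ u v * ∫ v' : V3, (1 / 2 * ∫ ω : Metric.sphere (0 : V3) 1,
              (⟪v' - v, (ω : V3)⟫_ℝ ^ 2 + 0) * ((ω : V3) k * (ω : V3) l) ∂sphereMeasure)
            ∂gaussMeasure u θ := by
          rw [integral_localMaxwellian_mul_eq_integral_gaussMeasure hθ u]
      _ = localMaxwellian 1 θ u v * (1 / 2 * ∫ ω : Metric.sphere (0 : V3) 1,
            (⟪u - v, (ω : V3)⟫_ℝ ^ 2 + θ + 0) * ((ω : V3) k * (ω : V3) l) ∂sphereMeasure) := by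
          rw [integral_const_mul, integral_gaussMeasure_sphereMoment hθ u v 0 k l]
      _ = localMaxwellian 1 θ u v * (1 / 2 * ∫ ω : Metric.sphere (0 : V3) 1,
            (⟪v - u, (ω : V3)⟫_ℝ ^ 2 + θ) * ((ω : V3) k * (ω : V3) l) ∂sphereMeasure) := by
          congr 3
          funext ω
          rw [add_zero, ← neg_sub v u, inner_neg_left, neg_sq]
  have hMM : ∫ v : V3, ∫ v' : V3, sphereMark (evenMark k l) v v' *
      localMaxwellian 1 θ u v * localMaxwellian 1 θ u v' = K := by
    simp_rw [hinner]
    rw [integral_localMaxwellian_mul_eq_integral_gaussMeasure hθ u, integral_const_mul,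
      integral_gaussMeasure_sphereMoment hθ u u θ k l, hK, ← integral_const_mul]
    congr 1
    funext ω
    simp only [sub_self, inner_zero_left, ne_eq, OfNat.ofNat_ne_zero, not_false_eq_true, zero_pow, zero_add]
    ring
  rw [hMM, hFM]

/-! ## The empirical side -/

/-- `S₀ Σ b_i (p_i − S₁/S₀)² = S₀ S₂ − S₁²` for `S₀ = Σ b_i ≠ 0`, `S₁ = Σ b_i p_i`, `S₂ = Σ b_i p_i²`. [folklore] -/
theorem sum_mul_sum_mul_sq_sub_div {n : ℕ} (b p : Fin n → ℝ) (h0 : ∑ i, b i ≠ 0) :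
    (∑ i, b i) * ∑ i, b i * (p i - (∑ j, b j * p j) / ∑ j, b j) ^ 2 =
      (∑ i, b i) * (∑ i, b i * p i ^ 2) - (∑ i, b i * p i) ^ 2 := by
  have hexp : ∀ t : ℝ, ∑ i, b i * (p i - t) ^ 2 =
      (∑ i, b i * p i ^ 2) - 2 * t * (∑ i, b i * p i) + t ^ 2 * ∑ i, b i := by
    intro t
    have h : ∀ i, b i * (p i - t) ^ 2 = b i * p i ^ 2 - 2 * t * (b i * p i) + t ^ 2 * b i :=
      fun i => by ring
    simp only [h, Finset.sum_add_distrib, Finset.sum_sub_distrib, ← Finset.mul_sum]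
  rw [hexp]
  field_simp
  ring

/-- **Weighted-variance identity**: with nonnegative weights `b_i`, total weight `S₀` and weighted mean
`ū = S₀⁻¹ Σ b_i v_i` (junk `0⁻¹ = 0`), `S₀ Σ b_i ⟪v_i − ū, ω⟫² = S₀ Σ b_i ⟪v_i, ω⟫² − (Σ b_i ⟪v_i, ω⟫)²`
(for `S₀ = 0` every `b_i` vanishes and both sides are `0`). [folklore] -/
theorem weighted_variance_identity {n : ℕ} (b : Fin n → ℝ) (v : Fin n → V3) (hb : ∀ i, 0 ≤ b i) (ω : V3) :
    (∑ i, b i) * ∑ i, b i * ⟪v i - (∑ j, b j)⁻¹ • ∑ j, b j • v j, ω⟫_ℝ ^ 2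
      = (∑ i, b i) * (∑ i, b i * ⟪v i, ω⟫_ℝ ^ 2) - (∑ i, b i * ⟪v i, ω⟫_ℝ) ^ 2 := by
  by_cases hS : ∑ i, b i = 0
  · have hbi : ∀ i, b i = 0 := fun i =>
      (Finset.sum_eq_zero_iff_of_nonneg fun j _ => hb j).1 hS i (Finset.mem_univ i)
    simp [hbi]
  · have ht : ⟪(∑ j, b j)⁻¹ • ∑ j, b j • v j, ω⟫_ℝ = (∑ j, b j * ⟪v j, ω⟫_ℝ) / ∑ j, b j := by
      rw [real_inner_smul_left, sum_inner]
      simp_rw [real_inner_smul_left]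
      rw [inv_mul_eq_div]
    simp_rw [inner_sub_left, ht]
    exact sum_mul_sum_mul_sq_sub_div b (fun i => ⟪v i, ω⟫_ℝ) hS

/-- The mollified empirical momentum as a finite sum over particles: `m_r(x) = (N+1)⁻¹ Σ b_r(x_i, x) v_i`.
[folklore] -/
theorem mollMomentum_eq_sum {N : ℕ} (r : ℝ) (w : Config (N + 1) (Fin 3) T3) (x : T3) :
    mollMomentum r w x = ((N + 1 : ℕ) : ℝ)⁻¹ • ∑ i, coneKernel r (w i).1 x • (w i).2 := by
  unfold mollMomentum
  rw [empiricalMeasure_eq, integral_smul_measure, integral_finsetSum_measure]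
  · simp only [integral_dirac, ENNReal.toReal_inv, ENNReal.toReal_natCast]
  · exact fun i _ => integrable_dirac (by simp)

/-- The empirical velocity is the cone-weighted mean velocity: `u_r(x) = (Σ b_i)⁻¹ Σ b_i v_i` (both sides are the
junk `0` where `Σ b_i = 0`). [folklore] -/
theorem uC_eq_weightedMean {N : ℕ} (r : ℝ) (w : Config (N + 1) (Fin 3) T3) (x : T3) :
    KineticEntropyBalance.uC r w x =
      (∑ i, coneKernel r (w i).1 x)⁻¹ • ∑ i, coneKernel r (w i).1 x • (w i).2 := by
  have hc0 : (((N + 1 : ℕ) : ℝ))⁻¹ ≠ 0 := by positivity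
  unfold KineticEntropyBalance.uC
  rw [mollMomentum_eq_sum, mollDensity_eq_avg, smul_smul, mul_inv_rev, mul_assoc, inv_mul_cancel₀ hc0, mul_one]

/-- **Empirical side of the pointwise identity**: `ρ_r ∫ b_r F_{kl} dμ_w = B_r(Ξ_P^{kl})` for `0 < r`, with
`F_{kl}(v) = ∫_{S²} ⟪v − u_r, ω⟫² ω_kω_l dσ`. [folklore] -/
theorem mollDensity_mul_oneBody_eq_pairFunctional {N : ℕ} (k l : Fin 3) {r : ℝ} (hr : 0 < r)
    (w : Config (N + 1) (Fin 3) T3) (x : T3) :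
    mollDensity r w x *
        ∫ q, coneKernel r q.1 x *
          (∫ ω : Metric.sphere (0 : V3) 1,
              ⟪q.2 - KineticEntropyBalance.uC r w x, (ω : V3)⟫_ℝ ^ 2 * ((ω : V3) k * (ω : V3) l) ∂sphereMeasure)
          ∂(empiricalMeasure w)
      = pairFunctional r (evenMark k l) w x := by
  haveI := isFiniteMeasure_sphereMeasure_V3
  have hb0 : ∀ i, 0 ≤ coneKernel r (w i).1 x := fun i => coneMollifier_nonneg hr _ _
  set U : V3 := KineticEntropyBalance.uC r w x with hU
  have hB : pairFunctional r (evenMark k l) w x = ((N + 1 : ℕ) : ℝ)⁻¹ * ((N + 1 : ℕ) : ℝ)⁻¹ *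
      ∫ ω : Metric.sphere (0 : V3) 1,
        ((∑ i, coneKernel r (w i).1 x) * (∑ i, coneKernel r (w i).1 x * ⟪(w i).2, ((ω : V3))⟫_ℝ ^ 2) -
          (∑ i, coneKernel r (w i).1 x * ⟪(w i).2, ((ω : V3))⟫_ℝ) ^ 2) *
        ((ω : V3) k * (ω : V3) l) ∂sphereMeasure := by
    simp only [coneKernel]
    exact pairFunctionalP_eq_moment k l r w x
  have hswap : ∑ i, coneKernel r (w i).1 x * ∫ ω : Metric.sphere (0 : V3) 1,
        ⟪(w i).2 - U, (ω : V3)⟫_ℝ ^ 2 * ((ω : V3) k * (ω : V3) l) ∂sphereMeasure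
      = ∫ ω : Metric.sphere (0 : V3) 1, (∑ i, coneKernel r (w i).1 x * ⟪(w i).2 - U, (ω : V3)⟫_ℝ ^ 2) *
          ((ω : V3) k * (ω : V3) l) ∂sphereMeasure := by
    have hI : ∀ i, Integrable (fun ω : Metric.sphere (0 : V3) 1 =>
        coneKernel r (w i).1 x * (⟪(w i).2 - U, (ω : V3)⟫_ℝ ^ 2 * ((ω : V3) k * (ω : V3) l))) sphereMeasure :=
      fun i => integrable_sphereMeasure_of_continuous_V3 (by fun_prop)
    symm
    calc ∫ ω : Metric.sphere (0 : V3) 1, (∑ i, coneKernel r (w i).1 x * ⟪(w i).2 - U, (ω : V3)⟫_ℝ ^ 2) *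
          ((ω : V3) k * (ω : V3) l) ∂sphereMeasure
        = ∫ ω : Metric.sphere (0 : V3) 1, ∑ i, coneKernel r (w i).1 x *
            (⟪(w i).2 - U, (ω : V3)⟫_ℝ ^ 2 * ((ω : V3) k * (ω : V3) l)) ∂sphereMeasure := by
          congr 1
          funext ω
          rw [Finset.sum_mul]
          exact Finset.sum_congr rfl fun i _ => by ring
      _ = ∑ i, ∫ ω : Metric.sphere (0 : V3) 1, coneKernel r (w i).1 x *
            (⟪(w i).2 - U, (ω : V3)⟫_ℝ ^ 2 * ((ω : V3) k * (ω : V3) l)) ∂sphereMeasure :=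
          integral_finsetSum _ (fun i _ => hI i)
      _ = ∑ i, coneKernel r (w i).1 x * ∫ ω : Metric.sphere (0 : V3) 1,
            ⟪(w i).2 - U, (ω : V3)⟫_ℝ ^ 2 * ((ω : V3) k * (ω : V3) l) ∂sphereMeasure :=
          Finset.sum_congr rfl fun i _ => integral_const_mul _ _
  rw [integral_empiricalMeasure, hswap, mollDensity_eq_avg, hB, mul_assoc,
    mul_left_comm (∑ i, coneKernel r (w i).1 x), ← mul_assoc]
  congr 1
  rw [← integral_const_mul]
  refine integral_congr_ae (Eventually.of_forall fun ω => ?_)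
  simp only
  rw [← mul_assoc, hU, uC_eq_weightedMean]
  congr 1
  exact weighted_variance_identity (fun i => coneKernel r (w i).1 x) (fun i => (w i).2) hb0 (ω : V3)

/-! ## The registered stub -/

/-- **S6a · POINTWISE SECOND-MOMENT IDENTITY** (registered stub `stub_enskogPointwise` of the line
`stationary-microscale-hierarchy-entrance-law`, crux `JParityClosure.EvenStressEnskog`): for one configuration `w`,
one centre `x`, one pair `(k, l)` and `0 < r`,
`ρ_r² ⟨Θ(Ξ_P^{kl})⟩_{M⊗M} − B_r(Ξ_P^{kl}) = ρ_r (ρ_r ⟨F_{kl}⟩_M − ⟨b_r F_{kl}⟩_{μ_w})` with `M = localMaxwellian 1 θ_r u_r`,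
`F_{kl}(v) = ∫_{S²} ⟪v − u_r, ω⟫² ω_kω_l dσ` — from `maxwellian_pair_moment_eq` (the two Maxwellian terms agree) and
`mollDensity_mul_oneBody_eq_pairFunctional` (`ρ_r ⟨b_r F_{kl}⟩_{μ_w} = B_r`). [folklore] -/
theorem stub_enskogPointwise :
  ∀ (N : ℕ) (k l : Fin 3) (r : ℝ), 0 < r → ∀ (w : Config (N + 1) (Fin 3) T3) (x : T3),
    mollDensity r w x ^ 2 *
        (∫ v : V3, ∫ v' : V3, sphereMark (evenMark k l) v v' *
          localMaxwellian 1 (mollTemperature r w x) (KineticEntropyBalance.uC r w x) v *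
          localMaxwellian 1 (mollTemperature r w x) (KineticEntropyBalance.uC r w x) v')
      - pairFunctional r (evenMark k l) w x
    = mollDensity r w x *
        (mollDensity r w x *
          ∫ v : V3, (∫ ω : Metric.sphere (0 : V3) 1,
              ⟪v - KineticEntropyBalance.uC r w x, (ω : V3)⟫_ℝ ^ 2 * ((ω : V3) k * (ω : V3) l) ∂sphereMeasure) *
            localMaxwellian 1 (mollTemperature r w x) (KineticEntropyBalance.uC r w x) v)
      - mollDensity r w x *
        ∫ q, coneKernel r q.1 x *
          (∫ ω : Metric.sphere (0 : V3) 1,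
              ⟪q.2 - KineticEntropyBalance.uC r w x, (ω : V3)⟫_ℝ ^ 2 * ((ω : V3) k * (ω : V3) l) ∂sphereMeasure)
          ∂(empiricalMeasure w) := by
  intro N k l r hr w x
  rw [maxwellian_pair_moment_eq k l (mollTemperature r w x) (KineticEntropyBalance.uC r w x),
    ← mollDensity_mul_oneBody_eq_pairFunctional k l hr w x]
  ring

end Summit.AtomisticToContinuum.HydrodynamicLimit.Theorems.EvenStressEnskog

end
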